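import Literature.Analysis.Distribution.HormanderEstimates
import Literature.Analysis.Distribution.FieldIntegrationByParts
import Mathlib.Algebra.Order.Chebyshev
import HarnessLib

/-!
# Hörmander 1967, estimate (3.3) PROVED: `|||v|||² + |||X₀v|||'² ≤ C(‖v‖² + |||Pv|||'²)`

Analysis/Distribution support file for the decomposition of the named fact
`Literature.Analysis.Distribution.Hormander1967_thm11` (`Hypoelliptic.lean`). It PROVES the
elementary half of §3 of L. Hörmander, *Hypoelliptic second order differential equations*,
Acta Math. 119 (1967), p. 152, for `P = ∑_j X_j² + X₀ + c` (smooth real vector fields and a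
smooth `c` on a finite-dimensional real space with a Haar measure `μ`, the setting of
`Hormander1967_thm11`) and the norms of `HormanderEstimates.lean`:

* (3.1)–(3.2) `energy_estimate`: `|||v|||² ≤ 4|||Pv|||'² + 2C₁‖v‖²` for smooth `v` supported
  in the compact `K ⊆ Ω`, from the energy identity `∫ vPv = -∑‖X_jv‖² - ∑∫(div X_j)v X_jv
  - ½∫(div X₀)v² + ∫ cv²` (`FieldIntegrationByParts.lean`), the bounds of the coefficients on
  `K`, and the pairing `-∫ vPv ≤ |||v||| |||Pv|||'`;
* `tripleDualNorm_fieldDeriv_le`: `|||X₀v|||' ≤ |||Pv|||' + (1 + A)∑_j‖X_jv‖ + A‖v‖`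
  ("Noting that `|||X_jf|||' ≤ C‖f‖`, `f ∈ C_0^∞(K)`, we conclude that
  `|||X_j²v|||' ≤ C‖X_jv‖ ≤ C|||v|||`");
* `Hormander1967_estimate33`: **(3.3)** "`|||v|||² + |||X₀v|||'² ≤ C(‖v‖² + |||Pv|||'²)`,
  `v ∈ C_0^∞(K)`", with `C = C(K)`.

No bracket condition is involved. Constants are explicit but not optimised.

## References

* L. Hörmander, *Hypoelliptic second order differential equations*, Acta Math. 119 (1967)
  147–171, p. 152, (3.1)–(3.3).
-/

noncomputable section

open MeasureTheory TopologicalSpace Set Function Filter Distributions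
open scoped ContDiff Topology

namespace Literature.Analysis.Distribution

variable {E : Type*} [NormedAddCommGroup E] [NormedSpace ℝ E] [FiniteDimensional ℝ E]
  [MeasurableSpace E] [BorelSpace E] {μ : Measure E} [μ.IsAddHaarMeasure]

/-! ### Elementary integral bounds -/

omit [NormedSpace ℝ E] [FiniteDimensional ℝ E] [μ.IsAddHaarMeasure] in
/-- `|∫ a f g| ≤ A‖f‖‖g‖` if `|a| ≤ A` on the support of `f` (`f`, `g` continuous and
compactly supported; no hypothesis on the weight `a` is needed beyond the bound, the Bochner
integral being `0` on non-integrable functions): Cauchy–Schwarz with a bounded weight.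
[folklore] -/
theorem abs_integral_mul_mul_le [IsFiniteMeasureOnCompacts μ] {a f g : E → ℝ} {A : ℝ}
    (hA : 0 ≤ A) (hf : Continuous f) (hg : Continuous g)
    (hfc : HasCompactSupport f) (hgc : HasCompactSupport g)
    (hbound : ∀ x ∈ tsupport f, |a x| ≤ A) :
    |∫ x, a x * f x * g x ∂μ| ≤ A * l2Norm μ f * l2Norm μ g := by
  have hpt : ∀ x, |a x * f x * g x| ≤ A * (|f x| * |g x|) := by
    intro x
    by_cases hx : f x = 0
    · simp [hx]
    · rw [abs_mul, abs_mul, mul_assoc]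
      exact mul_le_mul_of_nonneg_right (hbound x (subset_tsupport _ (mem_support.2 hx)))
        (mul_nonneg (abs_nonneg _) (abs_nonneg _))
  have hfa : HasCompactSupport fun x => |f x| := hfc.norm
  have hint : Integrable (fun x => A * (|f x| * |g x|)) μ :=
    (continuous_const.mul (hf.abs.mul hg.abs)).integrable_of_hasCompactSupport
      ((hfa.mul_right (f' := fun x => |g x|)).mul_left (f := fun _ => A))
  have hfm : MemLp (fun x => |f x|) 2 μ := hf.abs.memLp_of_hasCompactSupport hfa
  have hgm : MemLp (fun x => |g x|) 2 μ := hg.abs.memLp_of_hasCompactSupport hgc.norm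
  have hCS := abs_integral_mul_le_l2Norm_mul hfm hgm
  have ef : l2Norm μ (fun x => |f x|) = l2Norm μ f := by simp [l2Norm, sq_abs]
  have eg : l2Norm μ (fun x => |g x|) = l2Norm μ g := by simp [l2Norm, sq_abs]
  rw [ef, eg, abs_of_nonneg (integral_nonneg fun x => mul_nonneg (abs_nonneg _) (abs_nonneg _))]
    at hCS
  calc |∫ x, a x * f x * g x ∂μ| ≤ ∫ x, |a x * f x * g x| ∂μ := abs_integral_le_integral_abs
    _ ≤ ∫ x, A * (|f x| * |g x|) ∂μ :=
        integral_mono_of_nonneg (Eventually.of_forall fun x => abs_nonneg _) hint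
          (Eventually.of_forall hpt)
    _ = A * ∫ x, |f x| * |g x| ∂μ := integral_const_mul _ _
    _ ≤ A * (l2Norm μ f * l2Norm μ g) := mul_le_mul_of_nonneg_left hCS hA
    _ = A * l2Norm μ f * l2Norm μ g := by ring

omit [NormedSpace ℝ E] [FiniteDimensional ℝ E] [μ.IsAddHaarMeasure] in
/-- `|∫ f g| ≤ ‖f‖‖g‖` for continuous compactly supported `f, g`. [folklore] -/
theorem abs_integral_mul_le_of_continuous [IsFiniteMeasureOnCompacts μ] {f g : E → ℝ}
    (hf : Continuous f) (hg : Continuous g) (hfc : HasCompactSupport f)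
    (hgc : HasCompactSupport g) : |∫ x, f x * g x ∂μ| ≤ l2Norm μ f * l2Norm μ g :=
  abs_integral_mul_le_l2Norm_mul (hf.memLp_of_hasCompactSupport hfc)
    (hg.memLp_of_hasCompactSupport hgc)

/-! ### (3.1)–(3.3) -/

variable {ι : Type*} [Fintype ι] {Ω : Opens E} {X₀ : E → E} {X : ι → E → E} {c : E → ℝ}
  {K : Set E} {A : ℝ}

omit [MeasurableSpace E] [BorelSpace E] in
/-- A common bound for the coefficients `div X_j`, `div X₀`, `c` on the compact `K`.
[folklore] -/
theorem exists_coeff_bound (hX₀ : ContDiff ℝ ∞ X₀) (hX : ∀ j, ContDiff ℝ ∞ (X j))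
    (hc : ContDiff ℝ ∞ c) (hK : IsCompact K) :
    ∃ A : ℝ, 0 ≤ A ∧ (∀ j, ∀ x ∈ K, |fieldDiv (X j) x| ≤ A) ∧ (∀ x ∈ K, |fieldDiv X₀ x| ≤ A) ∧
      ∀ x ∈ K, |c x| ≤ A := by
  have h1 : ∀ {Z : E → E}, ContDiff ℝ ∞ Z → ContDiff ℝ 1 Z := fun h =>
    h.of_le (by exact_mod_cast le_top)
  set m : E → ℝ := fun x => (∑ j, |fieldDiv (X j) x|) + |fieldDiv X₀ x| + |c x| with hm
  have hmc : Continuous m :=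
    ((continuous_finsetSum _ fun j _ => (continuous_fieldDiv (h1 (hX j))).abs).add
      (continuous_fieldDiv (h1 hX₀)).abs).add hc.continuous.abs
  obtain ⟨A₀, hA₀⟩ := hK.exists_bound_of_continuousOn hmc.continuousOn
  have hmA : ∀ x ∈ K, m x ≤ max A₀ 0 := fun x hx => by
    have h := hA₀ x hx
    rw [Real.norm_eq_abs] at h
    exact ((le_abs_self (m x)).trans h).trans (le_max_left _ _)
  have hs : ∀ x, 0 ≤ ∑ j, |fieldDiv (X j) x| := fun x =>
    Finset.sum_nonneg fun _ _ => abs_nonneg _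
  refine ⟨max A₀ 0, le_max_right _ _, fun j x hx => ?_, fun x hx => ?_, fun x hx => ?_⟩
  · have h := hmA x hx
    have hj : |fieldDiv (X j) x| ≤ ∑ j, |fieldDiv (X j) x| :=
      Finset.single_le_sum (f := fun j => |fieldDiv (X j) x|) (fun _ _ => abs_nonneg _)
        (Finset.mem_univ j)
    simp only [hm] at h
    linarith [abs_nonneg (fieldDiv X₀ x), abs_nonneg (c x)]
  · have h := hmA x hx
    simp only [hm] at h
    linarith [hs x, abs_nonneg (c x)]
  · have h := hmA x hx
    simp only [hm] at h
    linarith [hs x, abs_nonneg (fieldDiv X₀ x)]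

/-- **(3.1)**: `∑_j ‖X_jv‖² + ‖v‖² ≤ -2∫ vPv + C₁‖v‖²` with `C₁ = rA² + 3A + 1`
(`r` = number of fields `X_j`, `A` a bound of `div X_j`, `div X₀`, `c` on `K ⊇ supp v`): the
energy identity, the weighted Cauchy–Schwarz bounds `|∫(div X_j) v X_jv| ≤ A‖v‖‖X_jv‖ ≤
½‖X_jv‖² + ½A²‖v‖²`, `|∫ (div X₀) v²|, |∫ cv²| ≤ A‖v‖²`. [cite: Hormander1967, eq. (3.1)] -/
theorem energy_identity_bound (hX₀ : ContDiff ℝ ∞ X₀) (hX : ∀ j, ContDiff ℝ ∞ (X j))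
    (hc : ContDiff ℝ ∞ c) (hA : 0 ≤ A) (hAj : ∀ j, ∀ x ∈ K, |fieldDiv (X j) x| ≤ A)
    (hA₀ : ∀ x ∈ K, |fieldDiv X₀ x| ≤ A) (hAc : ∀ x ∈ K, |c x| ≤ A)
    {v : E → ℝ} (hv : ContDiff ℝ ∞ v) (hvc : HasCompactSupport v) (hvK : tsupport v ⊆ K) :
    (∑ j, l2Norm μ (fieldDeriv (X j) v) ^ 2) + l2Norm μ v ^ 2 ≤
      -2 * ∫ x, v x * hormanderOp X₀ X c v x ∂μ +
        (Fintype.card ι * A ^ 2 + 3 * A + 1) * l2Norm μ v ^ 2 := by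
  have hL0 : 0 ≤ l2Norm μ v := l2Norm_nonneg μ v
  have hN0 : ∀ j, 0 ≤ l2Norm μ (fieldDeriv (X j) v) := fun j => l2Norm_nonneg μ _
  -- the energy identity
  have hid := integral_mul_hormanderOp_self (μ := μ) hX₀ hX hc hv hvc
  have hsq : ∀ j, ∫ x, fieldDeriv (X j) v x ^ 2 ∂μ = l2Norm μ (fieldDeriv (X j) v) ^ 2 :=
    fun j => (l2Norm_sq μ _).symm
  simp only [hsq] at hid
  -- the three lower-order terms
  have hXvc : ∀ j, Continuous (fieldDeriv (X j) v) := fun j =>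
    (contDiff_fieldDeriv (hX j) hv).continuous
  have hXvs : ∀ j, HasCompactSupport (fieldDeriv (X j) v) := fun j =>
    hasCompactSupport_fieldDeriv (X j) hvc
  have hb1 : ∀ j, |∫ x, fieldDiv (X j) x * v x * fieldDeriv (X j) v x ∂μ| ≤
      A * l2Norm μ v * l2Norm μ (fieldDeriv (X j) v) :=
    fun j => abs_integral_mul_mul_le hA hv.continuous (hXvc j) hvc (hXvs j)
      (fun x hx => hAj j x (hvK hx))
  have hb2 : |∫ x, fieldDiv X₀ x * v x ^ 2 ∂μ| ≤ A * l2Norm μ v ^ 2 := by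
    have e : (fun x => fieldDiv X₀ x * v x ^ 2) = fun x => fieldDiv X₀ x * v x * v x := by
      ext x; ring
    rw [e]
    exact (abs_integral_mul_mul_le hA hv.continuous hv.continuous hvc hvc
      (fun x hx => hA₀ x (hvK hx))).trans_eq (by ring)
  have hb3 : |∫ x, c x * v x ^ 2 ∂μ| ≤ A * l2Norm μ v ^ 2 := by
    have e : (fun x => c x * v x ^ 2) = fun x => c x * v x * v x := by ext x; ring
    rw [e]
    exact (abs_integral_mul_mul_le hA hv.continuous hv.continuous hvc hvc
      (fun x hx => hAc x (hvK hx))).trans_eq (by ring)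
  -- AM–GM on the first family
  have hb1' : ∀ j, |∫ x, fieldDiv (X j) x * v x * fieldDeriv (X j) v x ∂μ| ≤
      (1 / 2) * l2Norm μ (fieldDeriv (X j) v) ^ 2 + (1 / 2) * A ^ 2 * l2Norm μ v ^ 2 := fun j =>
    (hb1 j).trans (by nlinarith [sq_nonneg (l2Norm μ (fieldDeriv (X j) v) - A * l2Norm μ v)])
  have hsum : |∑ j, ∫ x, fieldDiv (X j) x * v x * fieldDeriv (X j) v x ∂μ| ≤
      (1 / 2) * (∑ j, l2Norm μ (fieldDeriv (X j) v) ^ 2) +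
        (1 / 2) * (Fintype.card ι * A ^ 2) * l2Norm μ v ^ 2 := by
    refine (Finset.abs_sum_le_sum_abs _ _).trans ?_
    have e : ∑ j, ((1 / 2) * l2Norm μ (fieldDeriv (X j) v) ^ 2 + (1 / 2) * A ^ 2 * l2Norm μ v ^ 2) =
        (1 / 2) * (∑ j, l2Norm μ (fieldDeriv (X j) v) ^ 2) +
          (1 / 2) * (Fintype.card ι * A ^ 2) * l2Norm μ v ^ 2 := by
      rw [Finset.sum_add_distrib, ← Finset.mul_sum, Finset.sum_const, Finset.card_univ,
        nsmul_eq_mul]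
      ring
    exact (Finset.sum_le_sum fun j _ => hb1' j).trans e.le
  -- combine
  have key : (∑ j, l2Norm μ (fieldDeriv (X j) v) ^ 2) = -(∫ x, v x * hormanderOp X₀ X c v x ∂μ) -
      (∑ j, ∫ x, fieldDiv (X j) x * v x * fieldDeriv (X j) v x ∂μ) -
      (1 / 2) * (∫ x, fieldDiv X₀ x * v x ^ 2 ∂μ) + ∫ x, c x * v x ^ 2 ∂μ := by
    rw [hid]; ring
  have habs1 := abs_le.1 hsum
  have habs2 := abs_le.1 hb2
  have habs3 := abs_le.1 hb3
  nlinarith [habs1.1, habs1.2, habs2.1, habs2.2, habs3.1, habs3.2, key, sq_nonneg (l2Norm μ v),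
    mul_nonneg hA (sq_nonneg (l2Norm μ v))]

omit [FiniteDimensional ℝ E] [MeasurableSpace E] [BorelSpace E] in
/-- `tsupport (Pf) ⊆ tsupport f`. [folklore] -/
theorem tsupport_hormanderOp_subset (X₀ : E → E) (X : ι → E → E) (c f : E → ℝ) :
    tsupport (hormanderOp X₀ X c f) ⊆ tsupport f := by
  have h1 : support (hormanderOp X₀ X c f) ⊆
      (⋃ j, support (fieldDeriv (X j) (fieldDeriv (X j) f))) ∪
        support (fieldDeriv X₀ f) ∪ support f := by
    intro x hx
    rw [mem_support] at hx
    by_contra h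
    simp only [mem_union, mem_iUnion, mem_support, not_or, not_exists, not_not] at h
    exact hx (by
      rw [hormanderOp, Finset.sum_eq_zero (fun j _ => h.1.1 j), h.1.2, h.2]
      ring)
  refine (closure_mono h1).trans ?_
  rw [closure_union, closure_union, closure_iUnion_of_finite]
  refine union_subset (union_subset (iUnion_subset fun j => ?_)
    (tsupport_fieldDeriv_subset X₀ f)) Subset.rfl
  exact (tsupport_fieldDeriv_subset _ _).trans (tsupport_fieldDeriv_subset _ _)

omit [FiniteDimensional ℝ E] [MeasurableSpace E] [BorelSpace E] in
/-- `Pf` is smooth for smooth data. [folklore] -/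
theorem contDiff_hormanderOp (hX₀ : ContDiff ℝ ∞ X₀) (hX : ∀ j, ContDiff ℝ ∞ (X j))
    (hc : ContDiff ℝ ∞ c) {f : E → ℝ} (hf : ContDiff ℝ ∞ f) :
    ContDiff ℝ ∞ (hormanderOp X₀ X c f) := by
  unfold hormanderOp
  exact ((ContDiff.sum fun j _ => contDiff_fieldDeriv (hX j) (contDiff_fieldDeriv (hX j) hf)).add
    (contDiff_fieldDeriv hX₀ hf)).add (hc.mul hf)

omit [FiniteDimensional ℝ E] in
/-- **The pairing bound** `|∫ v Pv dμ| ≤ |||Pv|||' |||v|||` for smooth `v` supported in the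
compact `K ⊆ Ω` (p. 152: "`-Re ∫ v̄Pv ≤ |||v||| |||Pv|||'`"). [cite: Hormander1967, p. 152] -/
theorem abs_integral_mul_hormanderOp_le (hX₀ : ContDiff ℝ ∞ X₀) (hX : ∀ j, ContDiff ℝ ∞ (X j))
    (hc : ContDiff ℝ ∞ c) (hK : IsCompact K) (hKΩ : K ⊆ (Ω : Set E)) {v : E → ℝ}
    (hv : ContDiff ℝ ∞ v) (hvK : tsupport v ⊆ K) :
    |∫ x, v x * hormanderOp X₀ X c v x ∂μ| ≤
      tripleDualNorm μ Ω X (hormanderOp X₀ X c v) * tripleNorm μ X v := by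
  have hvc : HasCompactSupport v := hK.of_isClosed_subset (isClosed_tsupport v) hvK
  have hPv : ContDiff ℝ ∞ (hormanderOp X₀ X c v) := contDiff_hormanderOp hX₀ hX hc hv
  have hPvc : HasCompactSupport (hormanderOp X₀ X c v) :=
    hvc.of_isClosed_subset (isClosed_tsupport _) (tsupport_hormanderOp_subset X₀ X c v)
  have e : (fun x => v x * hormanderOp X₀ X c v x) = fun x => hormanderOp X₀ X c v x * v x := by
    ext x; ring
  rw [e]
  -- `v` as a test function on `Ω`
  exact abs_integral_mul_le_tripleDualNorm_mul (μ := μ) Ω X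
    (hPv.continuous.memLp_of_hasCompactSupport hPvc) (⟨v, hv, hvc, hvK.trans hKΩ⟩ : 𝓓(Ω, ℝ))

/-- **(3.2)**: `|||v|||² ≤ 4|||Pv|||'² + 2C₁‖v‖²`, from (3.1) and the pairing
`-∫ vPv ≤ |||v||| |||Pv|||' ≤ ¼|||v|||² + |||Pv|||'²`. [cite: Hormander1967, eq. (3.2)] -/
theorem energy_estimate (hX₀ : ContDiff ℝ ∞ X₀) (hX : ∀ j, ContDiff ℝ ∞ (X j))
    (hc : ContDiff ℝ ∞ c) (hK : IsCompact K) (hKΩ : K ⊆ (Ω : Set E)) (hA : 0 ≤ A)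
    (hAj : ∀ j, ∀ x ∈ K, |fieldDiv (X j) x| ≤ A) (hA₀ : ∀ x ∈ K, |fieldDiv X₀ x| ≤ A)
    (hAc : ∀ x ∈ K, |c x| ≤ A) {v : E → ℝ} (hv : ContDiff ℝ ∞ v) (hvK : tsupport v ⊆ K) :
    tripleNorm μ X v ^ 2 ≤ 4 * tripleDualNorm μ Ω X (hormanderOp X₀ X c v) ^ 2 +
      2 * (Fintype.card ι * A ^ 2 + 3 * A + 1) * l2Norm μ v ^ 2 := by
  have hvc : HasCompactSupport v := hK.of_isClosed_subset (isClosed_tsupport v) hvK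
  have hT0 : 0 ≤ tripleNorm μ X v := tripleNorm_nonneg μ X v
  have hD0 : 0 ≤ tripleDualNorm μ Ω X (hormanderOp X₀ X c v) := tripleDualNorm_nonneg μ Ω X _
  have h31 := energy_identity_bound (μ := μ) hX₀ hX hc hA hAj hA₀ hAc hv hvc hvK
  rw [← tripleNorm_sq] at h31
  have hpair := abs_integral_mul_hormanderOp_le (μ := μ) hX₀ hX hc hK hKΩ hv hvK
  have hI := (neg_le_abs _).trans hpair
  nlinarith [hI, h31, sq_nonneg (tripleNorm μ X v - 2 * tripleDualNorm μ Ω X (hormanderOp X₀ X c v)),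
    mul_nonneg hD0 hT0]

/-- **`|||X₀v|||' ≤ |||Pv|||' + (1 + A)∑_j‖X_jv‖ + A‖v‖`** for smooth `v` supported in `K`
(p. 152: "Noting that `|||X_jf|||' ≤ C‖f‖`, `f ∈ C_0^∞(K)`, `j = 1, …, r`, we conclude that
`|||X_j²v|||' ≤ C‖X_jv‖ ≤ C|||v|||`"): write `X₀v = Pv - ∑_j X_j(X_jv) - cv` and pair with a
test function `w`, moving one `X_j` onto `w` (`∫ X_j(X_jv) w = ∫ (X_jv)(ᵗX_jw)`).
[cite: Hormander1967, eq. (3.3)] -/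
theorem tripleDualNorm_fieldDeriv_le (hX₀ : ContDiff ℝ ∞ X₀) (hX : ∀ j, ContDiff ℝ ∞ (X j))
    (hc : ContDiff ℝ ∞ c) (hK : IsCompact K) (hA : 0 ≤ A)
    (hAj : ∀ j, ∀ x ∈ K, |fieldDiv (X j) x| ≤ A) (hAc : ∀ x ∈ K, |c x| ≤ A) {v : E → ℝ}
    (hv : ContDiff ℝ ∞ v) (hvK : tsupport v ⊆ K) :
    tripleDualNorm μ Ω X (fieldDeriv X₀ v) ≤
      tripleDualNorm μ Ω X (hormanderOp X₀ X c v) +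
        (1 + A) * (∑ j, l2Norm μ (fieldDeriv (X j) v)) + A * l2Norm μ v := by
  have h1 : ∀ {Z : E → E}, ContDiff ℝ ∞ Z → ContDiff ℝ 1 Z := fun h =>
    h.of_le (by exact_mod_cast le_top)
  have hvc : HasCompactSupport v := hK.of_isClosed_subset (isClosed_tsupport v) hvK
  have hD0 : 0 ≤ tripleDualNorm μ Ω X (hormanderOp X₀ X c v) := tripleDualNorm_nonneg μ Ω X _
  have hL0 : 0 ≤ l2Norm μ v := l2Norm_nonneg μ v
  have hN0 : ∀ j, 0 ≤ l2Norm μ (fieldDeriv (X j) v) := fun j => l2Norm_nonneg μ _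
  have hPv : ContDiff ℝ ∞ (hormanderOp X₀ X c v) := contDiff_hormanderOp hX₀ hX hc hv
  have hPvc : HasCompactSupport (hormanderOp X₀ X c v) :=
    hvc.of_isClosed_subset (isClosed_tsupport _) (tsupport_hormanderOp_subset X₀ X c v)
  have hXv : ∀ j, ContDiff ℝ ∞ (fieldDeriv (X j) v) := fun j => contDiff_fieldDeriv (hX j) hv
  have hXvs : ∀ j, HasCompactSupport (fieldDeriv (X j) v) := fun j =>
    hasCompactSupport_fieldDeriv (X j) hvc
  have hXvK : ∀ j, tsupport (fieldDeriv (X j) v) ⊆ K := fun j =>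
    (tsupport_fieldDeriv_subset (X j) v).trans hvK
  have hXXv : ∀ j, ContDiff ℝ ∞ (fieldDeriv (X j) (fieldDeriv (X j) v)) := fun j =>
    contDiff_fieldDeriv (hX j) (hXv j)
  have hXXvs : ∀ j, HasCompactSupport (fieldDeriv (X j) (fieldDeriv (X j) v)) := fun j =>
    hasCompactSupport_fieldDeriv (X j) (hXvs j)
  have hM0 : 0 ≤ tripleDualNorm μ Ω X (hormanderOp X₀ X c v) +
      (1 + A) * (∑ j, l2Norm μ (fieldDeriv (X j) v)) + A * l2Norm μ v :=
    add_nonneg (add_nonneg hD0 (mul_nonneg (by linarith) (Finset.sum_nonneg fun j _ => hN0 j)))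
      (mul_nonneg hA hL0)
  refine tripleDualNorm_le_of_forall_le Ω X hM0 fun w => ?_
  have hTw0 : 0 ≤ tripleNorm μ X w := tripleNorm_nonneg μ X w
  have hwL : l2Norm μ w ≤ tripleNorm μ X w := l2Norm_le_tripleNorm μ X w
  have hwX : ∀ j, l2Norm μ (fieldDeriv (X j) w) ≤ tripleNorm μ X w := fun j =>
    l2Norm_fieldDeriv_le_tripleNorm μ X w j
  have hw1 : ContDiff ℝ 1 (w : E → ℝ) := w.contDiff.of_le (by exact_mod_cast le_top)
  have hXw : ∀ j, ContDiff ℝ ∞ (fieldDeriv (X j) w) := fun j => contDiff_fieldDeriv (hX j) w.contDiff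
  have hXws : ∀ j, HasCompactSupport (fieldDeriv (X j) w) := fun j =>
    hasCompactSupport_fieldDeriv (X j) w.hasCompactSupport
  -- split the pairing `∫ (X₀v) w = ∫ (Pv) w - ∑_j ∫ X_j(X_jv) w - ∫ c v w`
  have iP : Integrable (fun x => hormanderOp X₀ X c v x * w x) μ :=
    (hPv.continuous.mul w.continuous).integrable_of_hasCompactSupport hPvc.mul_right
  have iXX : ∀ j, Integrable (fun x => fieldDeriv (X j) (fieldDeriv (X j) v) x * w x) μ := fun j =>
    ((hXXv j).continuous.mul w.continuous).integrable_of_hasCompactSupport (hXXvs j).mul_right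
  have iS : Integrable (fun x => ∑ j, fieldDeriv (X j) (fieldDeriv (X j) v) x * w x) μ :=
    integrable_finsetSum _ fun j _ => iXX j
  have ic : Integrable (fun x => c x * v x * w x) μ :=
    ((hc.continuous.mul hv.continuous).mul w.continuous).integrable_of_hasCompactSupport
      (hvc.mul_left.mul_right)
  have hsplit : ∫ x, fieldDeriv X₀ v x * w x ∂μ = ∫ x, hormanderOp X₀ X c v x * w x ∂μ -
      (∑ j, ∫ x, fieldDeriv (X j) (fieldDeriv (X j) v) x * w x ∂μ) -
      ∫ x, c x * v x * w x ∂μ := by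
    have e : (fun x => fieldDeriv X₀ v x * w x) = fun x =>
        hormanderOp X₀ X c v x * w x - (∑ j, fieldDeriv (X j) (fieldDeriv (X j) v) x * w x) -
          c x * v x * w x := by
      ext x
      simp only [hormanderOp, ← Finset.sum_mul]
      ring
    have iPS : Integrable (fun x => hormanderOp X₀ X c v x * w x -
        ∑ j, fieldDeriv (X j) (fieldDeriv (X j) v) x * w x) μ := iP.sub iS
    rw [e, integral_sub iPS ic, integral_sub iP iS, integral_finsetSum _ fun j _ => iXX j]
  -- bound the three pieces
  have hbP : |∫ x, hormanderOp X₀ X c v x * w x ∂μ| ≤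
      tripleDualNorm μ Ω X (hormanderOp X₀ X c v) * tripleNorm μ X w :=
    abs_integral_mul_le_tripleDualNorm_mul (μ := μ) Ω X
      (hPv.continuous.memLp_of_hasCompactSupport hPvc) w
  have hbXX : ∀ j, |∫ x, fieldDeriv (X j) (fieldDeriv (X j) v) x * w x ∂μ| ≤
      (1 + A) * l2Norm μ (fieldDeriv (X j) v) * tripleNorm μ X w := by
    intro j
    rw [integral_fieldDeriv_mul (μ := μ) (h1 (hX j)) ((hXv j).of_le (by exact_mod_cast le_top))
      hw1 (hXvs j)]
    -- `∫ (X_jv)(ᵗX_jw) = -∫ (X_jv)(X_jw) - ∫ a_j (X_jv) w`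
    have iA : Integrable (fun x => fieldDeriv (X j) v x * fieldDeriv (X j) w x) μ :=
      ((hXv j).continuous.mul (hXw j).continuous).integrable_of_hasCompactSupport
        (hXvs j).mul_right
    have iB : Integrable (fun x => fieldDiv (X j) x * fieldDeriv (X j) v x * w x) μ :=
      (((continuous_fieldDiv (h1 (hX j))).mul (hXv j).continuous).mul
        w.continuous).integrable_of_hasCompactSupport ((hXvs j).mul_left.mul_right)
    have e : (fun x => fieldDeriv (X j) v x * fieldTranspose (X j) w x) = fun x =>
        -(fieldDeriv (X j) v x * fieldDeriv (X j) w x) -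
          fieldDiv (X j) x * fieldDeriv (X j) v x * w x := by
      ext x; simp only [fieldTranspose, fieldDeriv_apply]; ring
    have iAn : Integrable (fun x => -(fieldDeriv (X j) v x * fieldDeriv (X j) w x)) μ := iA.neg
    rw [e, integral_sub iAn iB, integral_neg]
    have hbA : |∫ x, fieldDeriv (X j) v x * fieldDeriv (X j) w x ∂μ| ≤
        l2Norm μ (fieldDeriv (X j) v) * tripleNorm μ X w :=
      (abs_integral_mul_le_of_continuous (hXv j).continuous (hXw j).continuous (hXvs j)
        (hXws j)).trans (mul_le_mul_of_nonneg_left (hwX j) (hN0 j))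
    have hbB : |∫ x, fieldDiv (X j) x * fieldDeriv (X j) v x * w x ∂μ| ≤
        A * l2Norm μ (fieldDeriv (X j) v) * tripleNorm μ X w :=
      (abs_integral_mul_mul_le hA (hXv j).continuous w.continuous (hXvs j) w.hasCompactSupport
        (fun x hx => hAj j x (hXvK j hx))).trans
        (mul_le_mul_of_nonneg_left hwL (mul_nonneg hA (hN0 j)))
    calc |-(∫ x, fieldDeriv (X j) v x * fieldDeriv (X j) w x ∂μ) -
          ∫ x, fieldDiv (X j) x * fieldDeriv (X j) v x * w x ∂μ|
        ≤ |∫ x, fieldDeriv (X j) v x * fieldDeriv (X j) w x ∂μ| +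
          |∫ x, fieldDiv (X j) x * fieldDeriv (X j) v x * w x ∂μ| := by
            refine (abs_sub _ _).trans (le_of_eq ?_); rw [abs_neg]
      _ ≤ l2Norm μ (fieldDeriv (X j) v) * tripleNorm μ X w +
          A * l2Norm μ (fieldDeriv (X j) v) * tripleNorm μ X w := add_le_add hbA hbB
      _ = (1 + A) * l2Norm μ (fieldDeriv (X j) v) * tripleNorm μ X w := by ring
  have hbc : |∫ x, c x * v x * w x ∂μ| ≤ A * l2Norm μ v * tripleNorm μ X w :=
    (abs_integral_mul_mul_le hA hv.continuous w.continuous hvc w.hasCompactSupport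
      (fun x hx => hAc x (hvK hx))).trans (mul_le_mul_of_nonneg_left hwL (mul_nonneg hA hL0))
  have hbS : |∑ j, ∫ x, fieldDeriv (X j) (fieldDeriv (X j) v) x * w x ∂μ| ≤
      (1 + A) * (∑ j, l2Norm μ (fieldDeriv (X j) v)) * tripleNorm μ X w := by
    refine (Finset.abs_sum_le_sum_abs _ _).trans ?_
    rw [Finset.mul_sum, Finset.sum_mul]
    exact Finset.sum_le_sum fun j _ => hbXX j
  rw [hsplit]
  calc |∫ x, hormanderOp X₀ X c v x * w x ∂μ -
          (∑ j, ∫ x, fieldDeriv (X j) (fieldDeriv (X j) v) x * w x ∂μ) - ∫ x, c x * v x * w x ∂μ|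
      ≤ |∫ x, hormanderOp X₀ X c v x * w x ∂μ| +
          |∑ j, ∫ x, fieldDeriv (X j) (fieldDeriv (X j) v) x * w x ∂μ| +
          |∫ x, c x * v x * w x ∂μ| := by
        exact (abs_sub _ _).trans (add_le_add (abs_sub _ _) le_rfl)
    _ ≤ tripleDualNorm μ Ω X (hormanderOp X₀ X c v) * tripleNorm μ X w +
          (1 + A) * (∑ j, l2Norm μ (fieldDeriv (X j) v)) * tripleNorm μ X w +
          A * l2Norm μ v * tripleNorm μ X w := add_le_add (add_le_add hbP hbS) hbc
    _ = (tripleDualNorm μ Ω X (hormanderOp X₀ X c v) +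
          (1 + A) * (∑ j, l2Norm μ (fieldDeriv (X j) v)) + A * l2Norm μ v) * tripleNorm μ X w := by
        ring

/-- **Hörmander 1967, estimate (3.3), PROVED**: for `P = ∑_j X_j² + X₀ + c` with smooth
coefficients on a finite-dimensional real space with a Haar measure `μ`, and every compact
`K ⊆ Ω`, there is `C` with "`|||v|||² + |||X₀v|||'² ≤ C(‖v‖² + |||Pv|||'²)`, `v ∈ C_0^∞(K)`"
(the norms of `HormanderEstimates.lean`; `|||·|||'` relative to `𝓓(Ω)`). No bracket condition
is involved. [cite: Hormander1967, eq. (3.3)] -/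
theorem Hormander1967_estimate33 (hX₀ : ContDiff ℝ ∞ X₀) (hX : ∀ j, ContDiff ℝ ∞ (X j))
    (hc : ContDiff ℝ ∞ c) (Ω : Opens E) (hK : IsCompact K) (hKΩ : K ⊆ (Ω : Set E)) :
    ∃ C : ℝ, ∀ v : E → ℝ, ContDiff ℝ ∞ v → tsupport v ⊆ K →
      tripleNorm μ X v ^ 2 + tripleDualNorm μ Ω X (fieldDeriv X₀ v) ^ 2 ≤
        C * (l2Norm μ v ^ 2 + tripleDualNorm μ Ω X (hormanderOp X₀ X c v) ^ 2) := by
  obtain ⟨A, hA, hAj, hA₀, hAc⟩ := exists_coeff_bound hX₀ hX hc hK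
  have hr0 : (0 : ℝ) ≤ Fintype.card ι := Nat.cast_nonneg _
  have hC₁0 : (0 : ℝ) ≤ Fintype.card ι * A ^ 2 + 3 * A + 1 := by positivity
  have hα0 : (0 : ℝ) ≤ 1 + 3 * (1 + A) ^ 2 * Fintype.card ι := by positivity
  refine ⟨(1 + 3 * (1 + A) ^ 2 * Fintype.card ι) * (4 + 2 * (Fintype.card ι * A ^ 2 + 3 * A + 1))
    + 3 + 3 * A ^ 2, fun v hv hvK => ?_⟩
  have hT0 : 0 ≤ tripleNorm μ X v := tripleNorm_nonneg μ X v
  have hB0 : 0 ≤ tripleDualNorm μ Ω X (fieldDeriv X₀ v) := tripleDualNorm_nonneg μ Ω X _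
  have hD0 : 0 ≤ tripleDualNorm μ Ω X (hormanderOp X₀ X c v) := tripleDualNorm_nonneg μ Ω X _
  have hL0 : 0 ≤ l2Norm μ v := l2Norm_nonneg μ v
  have hN0 : ∀ j, 0 ≤ l2Norm μ (fieldDeriv (X j) v) := fun j => l2Norm_nonneg μ _
  have hS0 : 0 ≤ ∑ j, l2Norm μ (fieldDeriv (X j) v) := Finset.sum_nonneg fun j _ => hN0 j
  -- (3.2)
  have hE2 := energy_estimate (μ := μ) hX₀ hX hc hK hKΩ hA hAj hA₀ hAc hv hvK
  -- the dual bound for `X₀v`, squared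
  have hBle := tripleDualNorm_fieldDeriv_le (μ := μ) (Ω := Ω) hX₀ hX hc hK hA hAj hAc hv hvK
  have hB2 : tripleDualNorm μ Ω X (fieldDeriv X₀ v) ^ 2 ≤
      3 * tripleDualNorm μ Ω X (hormanderOp X₀ X c v) ^ 2 +
        3 * (1 + A) ^ 2 * (∑ j, l2Norm μ (fieldDeriv (X j) v)) ^ 2 + 3 * A ^ 2 * l2Norm μ v ^ 2 := by
    have h1 := pow_le_pow_left₀ hB0 hBle 2
    nlinarith [sq_nonneg (tripleDualNorm μ Ω X (hormanderOp X₀ X c v) -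
        (1 + A) * ∑ j, l2Norm μ (fieldDeriv (X j) v)),
      sq_nonneg (tripleDualNorm μ Ω X (hormanderOp X₀ X c v) - A * l2Norm μ v),
      sq_nonneg ((1 + A) * (∑ j, l2Norm μ (fieldDeriv (X j) v)) - A * l2Norm μ v)]
  -- `(∑ ‖X_jv‖)² ≤ r ∑ ‖X_jv‖² ≤ r |||v|||²`
  have hS2 : (∑ j, l2Norm μ (fieldDeriv (X j) v)) ^ 2 ≤ Fintype.card ι * tripleNorm μ X v ^ 2 := by
    have h1 : (∑ j, l2Norm μ (fieldDeriv (X j) v)) ^ 2 ≤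
        Fintype.card ι * ∑ j, l2Norm μ (fieldDeriv (X j) v) ^ 2 := by
      have := sq_sum_le_card_mul_sum_sq (s := Finset.univ)
        (f := fun j => l2Norm μ (fieldDeriv (X j) v))
      rwa [Finset.card_univ] at this
    have h2 : ∑ j, l2Norm μ (fieldDeriv (X j) v) ^ 2 ≤ tripleNorm μ X v ^ 2 := by
      rw [tripleNorm_sq]
      exact le_add_of_nonneg_right (sq_nonneg _)
    exact h1.trans (mul_le_mul_of_nonneg_left h2 hr0)
  -- combine
  have hS3 : 3 * (1 + A) ^ 2 * (∑ j, l2Norm μ (fieldDeriv (X j) v)) ^ 2 ≤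
      3 * (1 + A) ^ 2 * (Fintype.card ι * tripleNorm μ X v ^ 2) :=
    mul_le_mul_of_nonneg_left hS2 (by positivity)
  have hfin : (1 + 3 * (1 + A) ^ 2 * Fintype.card ι) * tripleNorm μ X v ^ 2 ≤
      (1 + 3 * (1 + A) ^ 2 * Fintype.card ι) *
        (4 * tripleDualNorm μ Ω X (hormanderOp X₀ X c v) ^ 2 +
          2 * (Fintype.card ι * A ^ 2 + 3 * A + 1) * l2Norm μ v ^ 2) :=
    mul_le_mul_of_nonneg_left hE2 hα0
  nlinarith [hB2, hS3, hfin, mul_nonneg hα0 (sq_nonneg (l2Norm μ v)),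
    mul_nonneg (mul_nonneg hα0 hC₁0) (sq_nonneg (tripleDualNorm μ Ω X (hormanderOp X₀ X c v))),
    mul_nonneg (sq_nonneg A) (sq_nonneg (tripleDualNorm μ Ω X (hormanderOp X₀ X c v))),
    sq_nonneg (l2Norm μ v), sq_nonneg (tripleDualNorm μ Ω X (hormanderOp X₀ X c v))]

/-- **(3.5) from (3.4)**: on any open `Ω`, the main estimate (3.4) with gain `ε` on the compact
subsets of `Ω` implies the a priori estimate (3.5) with the same gain, by the PROVED (3.3)
(p. 153: "Combining this with (3.3) we obtain (3.5)"). [cite: Hormander1967, eq. (3.5)] -/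
theorem APrioriEstimateOn.of_mainEstimateOn (hX₀ : ContDiff ℝ ∞ X₀) (hX : ∀ j, ContDiff ℝ ∞ (X j))
    (hc : ContDiff ℝ ∞ c) {Ω : Opens E} {ε : ℝ} (h34 : MainEstimateOn μ Ω X₀ X ε) :
    APrioriEstimateOn μ Ω X₀ X c ε := by
  intro K hK hKΩ
  obtain ⟨C₁, hC₁⟩ := h34 K hK hKΩ
  obtain ⟨C₂, hC₂⟩ := Hormander1967_estimate33 (μ := μ) hX₀ hX hc Ω hK hKΩ
  refine ⟨max C₁ 0 * Real.sqrt (2 * max C₂ 0), fun v hv hvK => ?_⟩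
  exact est35_of_est33_of_est34 (tripleNorm_nonneg μ X v) (tripleDualNorm_nonneg μ Ω X _)
    (l2Norm_nonneg μ v) (tripleDualNorm_nonneg μ Ω X _) (hC₁ v hv hvK) (hC₂ v hv hvK)

end Literature.Analysis.Distribution
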